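import Mathlib
import HarnessLib
import Summits.NavierStokesRegularity.NavierStokesRegularity.Theses.FilamentPinchDoor
import Summits.NavierStokesRegularity.NavierStokesRegularity.Theses.AxisTwistDoor
import Summits.NavierStokesRegularity.NavierStokesRegularity.Theorems.FilamentPinchDoorFilamentaryGrowthStubSliceEnergyGrowth
import Summits.NavierStokesRegularity.NavierStokesRegularity.Theorems.FilamentPinchDoorFilamentaryGrowthStubSignedMassOfSliceEnergy

/-!
# `FilamentPinchDoor.FilamentaryGrowth` = `AxisTwistDoor.FilamentaryGrowth` (shared item
# stmt-NavierStokesRegularity-26431) — PROVED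

**Statement (verbatim route decl, identical text in both route files).**  For a profile `v` of the energy
class (Type-I rate `‖v(t,x)‖ ≤ C/√(−t)`, continuous on the open slab `(−∞,0) × ℝ³`, unit-viscosity Oseen-mild
between negative times, divergence-free slices, suitable weak on the backward slab with a weak spatial gradient `H`
and Albritton–Barker's `𝐈 = typeIBound ((−∞,0) × ℝ³) v π H < ∞`) and a direction `e ≠ 0` with
`⟪curl v(s,y), e⟫ ≥ 0` everywhere, there is `K` with `∫_{B(x,R)} ⟪curl v(s,y), e⟫ dy ≤ K·R` for every `s < 0`,
every centre `x` and every radius `R > 0`: the one-signed vorticity component has FILAMENTARY (1-dimensional)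
mass growth, uniformly in time.

PROOF = the composition `FilamentaryGrowth_of` of the skeleton of record (planner ns-idea-6 g3 birth skeleton,
lead reshape r1: stub statements unfolded) with its two registered stubs, both landed:
* `stub_sliceEnergyGrowth` (`…FilamentPinchDoorFilamentaryGrowthStubSliceEnergyGrowth`): the slice Morrey bound
  `∫_{B(x,R)} ‖v(s)‖² ≤ 𝐈·R` at EVERY `s < 0` (Albritton–Barker's `A(Q') ≤ 𝐈` on the parabolic ball with vertex
  `min 0 (s + R²/2)`, a.e. in time, upgraded to every slice by continuity in time of the local energy);
* `stub_signedMassOfSliceEnergy` (`…FilamentPinchDoorFilamentaryGrowthStubSignedMassOfSliceEnergy`): the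
  kinematic heart — analytic slices, a scaled cutoff `φ` with `‖∇φ‖ ≤ L/R`, integration by parts of the curl onto
  `φ e`, `‖w‖ ≤ (R/2)‖w‖² + 1/(2R)` and the slice bound give `∫_{B(x,R)} ω_e ≤ ‖curlCLM‖ L ‖e‖ (3𝐈/2 + 4|B₁|)·R`.

HONEST FRAMING: crux #3 of the door routes FilamentPinchDoor / AxisTwistDoor (rung N0-LocalTubeDoorHalfSpace) — a
structural lemma about HYPOTHETICAL blow-up profiles (the energy class of a putative locally Type-I singularity).
Nothing here proves a Navier–Stokes regularity statement; no summit statement and no door leaf is proved by this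
file alone.
-/

noncomputable section

-- the summit and its single sub-problem share the name (CONVENTIONS §1), as in every Theorems file
set_option linter.dupNamespace false

namespace Summit.NavierStokesRegularity.NavierStokesRegularity.Theorems

open Summit.NavierStokesRegularity.NavierStokesRegularity.Theorems.FilamentPinchDoorFilamentaryGrowthStubSliceEnergyGrowth
open Summit.NavierStokesRegularity.NavierStokesRegularity.Theorems.FilamentPinchDoorFilamentaryGrowthStubSignedMassOfSliceEnergy

/-- **Item stmt-NavierStokesRegularity-26431** (`FilamentPinchDoor.FilamentaryGrowth`): in the energy class,
non-negativity of `⟪curl v, e⟫` alone forces filamentary growth `∫_{B(x,R)} ⟪curl v(s), e⟫ ≤ K·R` for every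
`s < 0`, `x`, `R > 0` (slice Morrey bound at every time, `stub_sliceEnergyGrowth`; cutoff + curl integration by
parts + AM–GM, `stub_signedMassOfSliceEnergy`).
[cite: AlbrittonBarker2019, §1 after Thm 1.1 (A(Q') ≤ 𝐈(ω)); MajdaBertozzi2002, §11.4.2 (one-signed vorticity: circulation controlled by local energy)] -/
theorem filamentPinchDoor_filamentaryGrowth_proof :
    Summit.NavierStokesRegularity.NavierStokesRegularity.Theses.FilamentPinchDoor.FilamentaryGrowth := by
  unfold Summit.NavierStokesRegularity.NavierStokesRegularity.Theses.FilamentPinchDoor.FilamentaryGrowth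
  intro C v π H hdecay hcont hmild hdiv hsw hwg hI e he hnn
  exact stub_signedMassOfSliceEnergy C v π H hdecay hcont hmild hdiv hsw hwg hI
    (stub_sliceEnergyGrowth C v π H hdecay hcont hmild hdiv hsw hwg hI) e he hnn

/-- **Item stmt-NavierStokesRegularity-26431, shared copy** (`AxisTwistDoor.FilamentaryGrowth`, verbatim the
same statement in route AxisTwistDoor): filamentary growth of a one-signed vorticity component in the energy
class — one proof serves both routes.
[cite: AlbrittonBarker2019, §1 after Thm 1.1; MajdaBertozzi2002, §11.4.2] -/
theorem axisTwistDoor_filamentaryGrowth_proof :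
    Summit.NavierStokesRegularity.NavierStokesRegularity.Theses.AxisTwistDoor.FilamentaryGrowth := by
  unfold Summit.NavierStokesRegularity.NavierStokesRegularity.Theses.AxisTwistDoor.FilamentaryGrowth
  intro C v π H hdecay hcont hmild hdiv hsw hwg hI e he hnn
  exact stub_signedMassOfSliceEnergy C v π H hdecay hcont hmild hdiv hsw hwg hI
    (stub_sliceEnergyGrowth C v π H hdecay hcont hmild hdiv hsw hwg hI) e he hnn

end Summit.NavierStokesRegularity.NavierStokesRegularity.Theorems

end
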